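import Summits.Ventures.HodgeRepro2.A2PontryaginLefschetz
import Summits.Ventures.HodgeRepro2.A2TwelvePlanes

/-!
# The bigrading of the twelve-plane model and the type of Theorem A's class (A2 annex — Hodge types)

The generators `a_p = gen (p, false)` and `b_p = gen (p, true)` of the model play the roles of the
`(1,0)`- and `(0,1)`-covectors; the **bigrading** `hgrading a b` is the span of the monomials with
`a` generators of the first kind and `b` of the second.  Products add bidegrees, `E_p` and
`θ = Σ c_p E_p` have bidegree `(1,1)`, `E_T` has bidegree `(|T|, |T|)`, the Weil monomials
`w_{P₀,false}` / `w_{P₀,true}` have bidegrees `(|P₀|, 0)` / `(0, |P₀|)`, and the plane contractions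
`Λ_p`, `Λ` have bidegree `(−1,−1)`.  Hence, by the operator identity, **Theorem A's class
`y = z ⋆ θ^k = κ' Λ^{n−k} z` of a class `z` of bidegree `(a + (n−k), b + (n−k))` has bidegree
`(a, b)`** (`pontryagin_theta_pow_mem_hgrading`): in the twelve-plane instance a surface class
`z` of bidegree `(10, 10)` gives `y` of bidegree `(2, 2)` (`pontryagin_theta_pow_four_mem_two_two`)
— the model's form of «`y ∈ H^4(B)` is a Hodge class» ((S3)).
-/

namespace Summit.Ventures.HodgeRepro2.A2HodgeTypeModel

open WeilPlanes WeilIntegral WeilDetect WeilCoproduct A2HardLefschetzOps A2PontryaginModel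
  A2PontryaginLefschetz

variable {ι : Type*} [DecidableEq ι]

/-- The number of generators of the first kind (`a_p`, type `(1,0)`) in a generator list. -/
def cA (l : List (Gen ι)) : ℕ := l.countP fun j => !j.2

/-- The number of generators of the second kind (`b_p`, type `(0,1)`) in a generator list. -/
def cB (l : List (Gen ι)) : ℕ := l.countP fun j => j.2

/-- The bigraded piece of bidegree `(a, b)`: the span of the monomials with `a` generators of the
first kind and `b` of the second. -/
noncomputable def hgrading (a b : ℕ) : Submodule ℂ (A ι) :=
  Submodule.span ℂ {x | ∃ l : List (Gen ι), cA l = a ∧ cB l = b ∧ x = mono l}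

/-- A monomial lies in its bidegree. -/
lemma mono_mem_hgrading (l : List (Gen ι)) : mono l ∈ hgrading (cA l) (cB l) :=
  Submodule.subset_span ⟨l, rfl, rfl, rfl⟩

omit [DecidableEq ι] in
/-- `cA` is additive on concatenation. -/
lemma cA_append (l l' : List (Gen ι)) : cA (l ++ l') = cA l + cA l' := List.countP_append

omit [DecidableEq ι] in
/-- `cB` is additive on concatenation. -/
lemma cB_append (l l' : List (Gen ι)) : cB (l ++ l') = cB l + cB l' := List.countP_append

/-- **Products add bidegrees.** -/
theorem mul_mem_hgrading {a b a' b' : ℕ} {x y : A ι} (hx : x ∈ hgrading a b)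
    (hy : y ∈ hgrading a' b') : x * y ∈ hgrading (a + a') (b + b') := by
  induction hx using Submodule.span_induction generalizing y with
  | mem x hx =>
    obtain ⟨l, hla, hlb, rfl⟩ := hx
    induction hy using Submodule.span_induction with
    | mem y hy =>
      obtain ⟨l', hla', hlb', rfl⟩ := hy
      rw [← mono_append, ← hla, ← hlb, ← hla', ← hlb', ← cA_append, ← cB_append]
      exact mono_mem_hgrading _
    | zero => rw [mul_zero]; exact Submodule.zero_mem _
    | add y y' _ _ h h' => rw [mul_add]; exact Submodule.add_mem _ h h'
    | smul r y _ h => rw [mul_smul_comm]; exact Submodule.smul_mem _ r h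
  | zero => rw [zero_mul]; exact Submodule.zero_mem _
  | add x x' _ _ h h' => rw [add_mul]; exact Submodule.add_mem _ (h hy) (h' hy)
  | smul r x _ h => rw [smul_mul_assoc]; exact Submodule.smul_mem _ r (h hy)

/-- `a_p` has bidegree `(1, 0)`. -/
lemma gen_false_mem_hgrading (p : ι) : gen (p, false) ∈ hgrading 1 0 := by
  have h := mono_mem_hgrading [(p, false)]
  simpa [mono, cA, cB] using h

/-- `b_p` has bidegree `(0, 1)`. -/
lemma gen_true_mem_hgrading (p : ι) : gen (p, true) ∈ hgrading 0 1 := by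
  have h := mono_mem_hgrading [(p, true)]
  simpa [mono, cA, cB] using h

/-- `E_p` has bidegree `(1, 1)`. -/
lemma E_mem_hgrading (p : ι) : E p ∈ hgrading 1 1 := by
  have h := mul_mem_hgrading (gen_false_mem_hgrading p) (gen_true_mem_hgrading p)
  exact h

/-- `E_T` has bidegree `(|T|, |T|)`. -/
lemma ET_mem_hgrading (T : Finset ι) : ET T ∈ hgrading T.card T.card := by
  induction T using Finset.induction_on with
  | empty => simpa [ET, mono, cA, cB] using mono_mem_hgrading ([] : List (Gen ι))
  | insert p T hp ih =>
    rw [ET_insert hp, Finset.card_insert_of_notMem hp, add_comm]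
    exact mul_mem_hgrading (E_mem_hgrading p) ih

/-- `w_{P₀,false}` has bidegree `(|P₀|, 0)`. -/
lemma weil_false_mem_hgrading (P₀ : Finset ι) : weil P₀ false ∈ hgrading P₀.card 0 := by
  have h := mono_mem_hgrading (weilList P₀ false)
  have ha : cA (weilList P₀ false) = P₀.card := by
    rw [cA, weilList, List.countP_map, ← Finset.length_toList]
    exact List.countP_eq_length.2 fun a _ => by simp
  have hb : cB (weilList P₀ false) = 0 := by
    rw [cB, weilList, List.countP_map]
    exact List.countP_eq_zero.2 fun a _ => by simp
  rw [ha, hb] at h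
  exact h

/-- `w_{P₀,true}` has bidegree `(0, |P₀|)`. -/
lemma weil_true_mem_hgrading (P₀ : Finset ι) : weil P₀ true ∈ hgrading 0 P₀.card := by
  have h := mono_mem_hgrading (weilList P₀ true)
  have ha : cA (weilList P₀ true) = 0 := by
    rw [cA, weilList, List.countP_map]
    exact List.countP_eq_zero.2 fun a _ => by simp
  have hb : cB (weilList P₀ true) = P₀.card := by
    rw [cB, weilList, List.countP_map, ← Finset.length_toList]
    exact List.countP_eq_length.2 fun a _ => by simp
  rw [ha, hb] at h
  exact h

/-- **A contraction by `a_p^*` has bidegree `(−1, 0)`.** -/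
theorem contr_dual_false_mem_hgrading (p : ι) {a b : ℕ} {x : A ι} (hx : x ∈ hgrading (a + 1) b) :
    contr (dual (p, false)) x ∈ hgrading a b := by
  induction hx using Submodule.span_induction with
  | mem x hx =>
    obtain ⟨l, hla, hlb, rfl⟩ := hx
    by_cases hnd : l.Nodup
    · by_cases hmem : (p, false) ∈ l
      · obtain ⟨ε, -, hε⟩ := contr_dual_mono_of_mem hnd hmem
        rw [hε]
        refine Submodule.smul_mem _ _ ?_
        have h := mono_mem_hgrading (l.erase (p, false))
        have ha : cA (l.erase (p, false)) = a := by
          rw [cA, List.countP_erase, if_pos ⟨hmem, rfl⟩, ← cA, hla, Nat.add_sub_cancel]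
        have hb : cB (l.erase (p, false)) = b := by
          rw [cB, List.countP_erase, if_neg (fun h => Bool.false_ne_true h.2), ← cB, hlb,
            Nat.sub_zero]
        rwa [ha, hb] at h
      · rw [contr_dual_mono_of_notMem hmem]; exact Submodule.zero_mem _
    · rw [mono_eq_zero_of_not_nodup hnd, map_zero]; exact Submodule.zero_mem _
  | zero => rw [map_zero]; exact Submodule.zero_mem _
  | add x y _ _ h h' => rw [map_add]; exact Submodule.add_mem _ h h'
  | smul r x _ h => rw [map_smul]; exact Submodule.smul_mem _ r h

/-- **A contraction by `b_p^*` has bidegree `(0, −1)`.** -/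
theorem contr_dual_true_mem_hgrading (p : ι) {a b : ℕ} {x : A ι} (hx : x ∈ hgrading a (b + 1)) :
    contr (dual (p, true)) x ∈ hgrading a b := by
  induction hx using Submodule.span_induction with
  | mem x hx =>
    obtain ⟨l, hla, hlb, rfl⟩ := hx
    by_cases hnd : l.Nodup
    · by_cases hmem : (p, true) ∈ l
      · obtain ⟨ε, -, hε⟩ := contr_dual_mono_of_mem hnd hmem
        rw [hε]
        refine Submodule.smul_mem _ _ ?_
        have h := mono_mem_hgrading (l.erase (p, true))
        have ha : cA (l.erase (p, true)) = a := by
          rw [cA, List.countP_erase, if_neg (fun h => Bool.false_ne_true h.2), ← cA, hla,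
            Nat.sub_zero]
        have hb : cB (l.erase (p, true)) = b := by
          rw [cB, List.countP_erase, if_pos ⟨hmem, rfl⟩, ← cB, hlb, Nat.add_sub_cancel]
        rwa [ha, hb] at h
      · rw [contr_dual_mono_of_notMem hmem]; exact Submodule.zero_mem _
    · rw [mono_eq_zero_of_not_nodup hnd, map_zero]; exact Submodule.zero_mem _
  | zero => rw [map_zero]; exact Submodule.zero_mem _
  | add x y _ _ h h' => rw [map_add]; exact Submodule.add_mem _ h h'
  | smul r x _ h => rw [map_smul]; exact Submodule.smul_mem _ r h

/-- **`Λ_p` has bidegree `(−1, −1)`.** -/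
theorem lamAt_mem_hgrading (p : ι) {a b : ℕ} {x : A ι} (hx : x ∈ hgrading (a + 1) (b + 1)) :
    lamAt p x ∈ hgrading a b :=
  contr_dual_true_mem_hgrading p (contr_dual_false_mem_hgrading p hx)

variable [Fintype ι]

/-- `θ` has bidegree `(1, 1)`. -/
lemma theta_mem_hgrading (c : ι → ℂ) : theta c ∈ hgrading 1 1 :=
  Submodule.sum_mem _ fun p _ => Submodule.smul_mem _ _ (E_mem_hgrading p)

/-- `θ^k` has bidegree `(k, k)`. -/
lemma theta_pow_mem_hgrading (c : ι → ℂ) (k : ℕ) : theta c ^ k ∈ hgrading k k := by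
  induction k with
  | zero => simpa [mono, cA, cB] using mono_mem_hgrading ([] : List (Gen ι))
  | succ k ih =>
    rw [pow_succ]
    exact mul_mem_hgrading ih (theta_mem_hgrading c)

/-- **`Λ` has bidegree `(−1, −1)`.** -/
theorem lam_mem_hgrading (c : ι → ℂ) {a b : ℕ} {x : A ι} (hx : x ∈ hgrading (a + 1) (b + 1)) :
    lam c x ∈ hgrading a b := by
  simp only [lam, LinearMap.sum_apply, LinearMap.smul_apply]
  exact Submodule.sum_mem _ fun p _ => Submodule.smul_mem _ _ (lamAt_mem_hgrading p hx)

/-- **`Λ^m` has bidegree `(−m, −m)`.** -/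
theorem lam_pow_mem_hgrading (c : ι → ℂ) (m : ℕ) {a b : ℕ} {x : A ι}
    (hx : x ∈ hgrading (a + m) (b + m)) : (lam c ^ m) x ∈ hgrading a b := by
  induction m generalizing a b with
  | zero => simpa using hx
  | succ m ih =>
    rw [pow_succ', Module.End.mul_apply]
    apply lam_mem_hgrading
    apply ih
    rwa [show a + 1 + m = a + (m + 1) by ring, show b + 1 + m = b + (m + 1) by ring]

/-- **The bidegree of Theorem A's class**: `z ⋆ θ^k = κ' Λ^{n−k} z` has bidegree `(a, b)` when
`z` has bidegree `(a + (n−k), b + (n−k))`. -/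
theorem pontryagin_theta_pow_mem_hgrading {c : ι → ℂ} (hc : ∀ p, c p ≠ 0) {k : ℕ}
    (hk : k ≤ Fintype.card ι) {a b : ℕ} {z : A ι}
    (hz : z ∈ hgrading (a + (Fintype.card ι - k)) (b + (Fintype.card ι - k))) :
    pontryagin z (theta c ^ k) ∈ hgrading a b := by
  rw [pontryagin_theta_pow_eq_smul_lam_pow hc hk z]
  exact Submodule.smul_mem _ _ (lam_pow_mem_hgrading c _ hz)

/-- **The twelve-plane instance**: a surface class `z` of bidegree `(10, 10)` gives Theorem A's class
`z ⋆ θ⁴` of bidegree `(2, 2)` — the model's form of «`y ∈ H^4(B)` is a Hodge class». -/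
theorem pontryagin_theta_pow_four_mem_two_two {c : A2TwelvePlanes.ι₁₂ → ℂ} (hc : ∀ p, c p ≠ 0)
    {z : A A2TwelvePlanes.ι₁₂} (hz : z ∈ hgrading 10 10) :
    pontryagin z (theta c ^ 4) ∈ hgrading 2 2 := by
  have h4 : 4 ≤ Fintype.card A2TwelvePlanes.ι₁₂ := by
    rw [Fintype.card_fin]; norm_num
  refine pontryagin_theta_pow_mem_hgrading hc h4 (a := 2) (b := 2) ?_
  rwa [show Fintype.card A2TwelvePlanes.ι₁₂ - 4 = 8 by rw [Fintype.card_fin]]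

end Summit.Ventures.HodgeRepro2.A2HodgeTypeModel
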